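import Literature.Algebra.Lie.LefschetzModuleVerticalSubalgebra
import HarnessLib

/-!
# Looijenga–Lunts (5.3): "`a` has the Lefschetz property in `Gr^ver M`" ⟺ the highest vertical component `a_{0,2}` is a Lefschetz operator of `(M, h_ver)`

Topic `Literature/Algebra/Lie` (namespace `Literature.Algebra.Lie`).  Lane `lit-hodgefound` (Track 2 foundations
library), skeleton seat `lit-hodgefound-skel-1` (generation 47), row **A1-152** of
`run/shared/lean/pub/lit-hodgefound/SKELETON.md`.  The VERTICAL counterpart of A1-151
(`HorizontalFiltrationLefschetzProperty.lean`) and companion of A1-150 (`LefschetzModuleVerticalSubalgebra.lean`),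
whose SCOPE (a) records that `Gr^ver M` is MODELLED by `(M, h_ver)` and that the printed hypothesis "`Gr^ver M` is a
Lefschetz module of `𝔞`" enters through the model clause `HasLefschetzProperty (h - H) a_0`.  This file proves that
the model clause IS the printed one: for `a` raising the (nondecreasing) vertical filtration
`ver_k M = ⊕_{m ≤ k} M_m(h_ver)` by at most `2` — `a ∈ ⊕_{l ≤ 2} 𝔤𝔩(M)_l(ad h_ver)`, as every element of `𝔞_ver` does —
the Lefschetz property "`a^n : Gr^ver_{-n} M ⥲ Gr^ver_n M` for all `n ≥ 0`", written in the lattice of submodules by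
the two clauses INJECTIVITY (`x ∈ ver_{-n}`, `a^n x ∈ ver_{n-1} ⟹ x ∈ ver_{-n-1}`) and SURJECTIVITY
(`ver_n ⊆ a^n ver_{-n} + ver_{n-1}`) — the content of the tree's `IsMonodromyWeightFiltration.inf_comap_le` /
`le_map_sup` (cf. `bijective_grPowMap`) in the RAISING orientation of (5.3), where the operator raises a nondecreasing
filtration (Cattani's `N W_i ⊆ W_{i-2}` shape used in A1-151 for `hor` does not apply verbatim to `ver`) — holds if
and only if the highest vertical component `a^{ver}_2 = gr^ver(a)` has the Lefschetz property on `M` graded by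
`h_ver`; and for `a ∈ 𝔞_ver` that component is `a_{0,2} = a_0` (`degreeComponent_ad_sub_two_eq`).  THEOREMS ONLY
(no definition, no named fact, no `sorry`; D-0026 net debt `0`); the commutator Lie ring on `𝔤𝔩(M)` is Mathlib's
reducible non-instance `LieRing.ofAssociativeRing`, enabled FILE-LOCALLY as in the whole series.

## Source, VERBATIM

E. Looijenga, V. A. Lunts, *A Lie algebra attached to a projective variety*, Invent. Math. **129** (1997) 361–412
(held TeX text `paper:arxiv-alg-geom_9604014`), §5:

> (5.1) p0020 L99–L106: "If `e` is a nilpotent transformation in a vector space `M`, then there is a unique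
> nonincreasing filtration `W^•` preserved by `e` such that `e` has the Lefschetz property in `Gr^•_W(M)`. Any
> `𝔰𝔩₂`-triple `(e, h, f)` containing `e` descends to an `𝔰𝔩₂`-triple in `Gr_W(M)` and splits the filtration […]."
> (5.3) p0021 L4–L9: "Then the associated vertical filtration is defined by `ver_k M := Σ_r hor^{r-k} M_r`. This
> filtration is nondecreasing; we call the corresponding grading of `Gr_ver M` the vertical grading. The notations
> `Gr_hor M` and `Gr^ver M` refer to the same vector space but with different gradings: `Gr^k_hor M_r = Gr^ver_{r-k} M_r`
> has horizontal degree `k` and vertical degree `r - k`."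
> (5.3) Proposition, p0021 L45–L50: "If in addition, `Gr^ver M` is a Lefschetz module of `𝔞`, then the span of the
> components of `𝔞` of highest vertical degree `2` make up an abelian subalgebra `𝔞_{0,2}` of `𝔤(𝔞, M)_{0,2}` that has
> the Lefschetz property in `M` with respect to the vertical grading. Moreover, `𝔤(𝔞_{0,2}, M_ver)` is a subalgebra of
> `𝔤(𝔞, M)_{0,•}` that maps isomorphically onto `𝔤(𝔞, Gr^ver M)`."

## Contents (all proved; `K` a field of characteristic `0`, `M` finite-dimensional, `W = h_ver` `ℤ`-diagonalisable)

* §1 the vertical filtration `ver_k M = ⨆_{m ≤ k} M_m(W)` (spelled out, as `hor` in A1-148/149/151):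
  `verFiltration_le_of_le`, `degreeSpace_le_verFiltration`, `map_verFiltration_le_of_mem_adDegree`,
  `apply_mem_verFiltration_of_mem_biSup_adDegree` / **`forall_apply_mem_verFiltration_iff`** (`a ver_k ⊆ ver_{k+c}`
  ⟺ `a ∈ ⊕_{l ≤ c} 𝔤𝔩(M)_l(ad W)`), `sub_degreeComponent_mem_biSup_le`, **`verFiltration_eq_sup`** /
  `disjoint_degreeSpace_verFiltration` (`ver_k = M_k(W) ⊕ ver_{k-1}`: the splitting of (5.1)),
  `eq_zero_of_mem_degreeSpace_of_mem_verFiltration`, `exists_verFiltration_eq_top/bot`, `pow_apply_mem_verFiltration`,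
  `degreeComponent_ad_two_apply_mem`, **`pow_apply_sub_pow_degreeComponent_apply_mem_verFiltration`**
  (`gr^ver(a^n) = (a^{ver}_2)^n`), and **`lefschetzOnGrVer_iff_hasLefschetzProperty`** (the bridge).
* §2 `degreeComponent_ad_sub_eq` (for `a` of total degree `2`, `[h, H] = 0`: the vertical component of degree `l` is
  the horizontal component of degree `2 - l`), `mem_biSup_adDegree_sub_of_mem_verticalPart` (`𝔞_ver ⊆ ⊕_{l ≤ 2}`),
  `degreeComponent_ad_sub_two_eq` (`a^{ver}_2 = a_0 = a_{0,2}`), and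
  **`IsLefschetzModule.isLefschetzModule_verticalZeroTwo_of_lefschetzOnGrVer`** — A1-150's `(𝔞_{0,2}, M_ver)` is a
  Lefschetz module under the PRINTED form of the hypothesis on the Lefschetz element.

## SCOPE

(a) `Gr^ver M` is not built as a quotient object (the two lattice clauses stand for bijectivity on the quotients);
the semisimplicity clause of "`Gr^ver M` is a Lefschetz module of `𝔞`" stays in model form (`𝔤(𝔞_{0,2}, M_ver)`
semisimple), see A1-150 SCOPE (a).  (b) Nothing here concerns complex tori or the Hodge conjecture.

## References

* [LooijengaLunts1997] E. Looijenga, V. A. Lunts, *A Lie algebra attached to a projective variety*, Invent. Math. 129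
  (1997) 361–412; arXiv:alg-geom/9604014. §5 (5.1) p. 20 L99–L106, (5.3) p. 21 L4–L9, Proposition L45–L50 of the
  held TeX text.
* [CattaniElZeinGriffithsLe2014] E. Cattani et al. (eds.), *Hodge Theory*, Math. Notes 49, App. A Prop. A.2.2 — for
  the lattice form of "bijective on graded pieces" (the tree's `IsMonodromyWeightFiltration`, `bijective_grPowMap`).
-/

namespace Literature.Algebra.Lie

open Module Function Set LieAlgebra

attribute [local instance 100] LieRing.ofAssociativeRing

section VerFiltration

variable {K : Type*} [Field K] [CharZero K] {M : Type*} [AddCommGroup M] [Module K M] [FiniteDimensional K M]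
  {W : Module.End K M}

omit [CharZero K] [FiniteDimensional K M] in
/-- The vertical filtration `ver_k M = ⊕_{m ≤ k} M_m(h_ver)` is nondecreasing. [cite: LooijengaLunts1997, §5 (5.3) p. 21 L4–L5 ("This filtration is nondecreasing")] -/
theorem verFiltration_le_of_le (W : Module.End K M) {k k' : ℤ} (hkk' : k ≤ k') :
    ⨆ (m : ℤ) (_ : m ≤ k), degreeSpace W m ≤ ⨆ (m : ℤ) (_ : m ≤ k'), degreeSpace W m :=
  iSup₂_le fun m hm ↦ le_iSup₂_of_le m (by omega) le_rfl

omit [CharZero K] [FiniteDimensional K M] in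
/-- `M_k(h_ver) ⊆ ver_k M`. [cite: LooijengaLunts1997, §5 (5.3) p. 21 L4–L6] -/
theorem degreeSpace_le_verFiltration (W : Module.End K M) (k : ℤ) :
    degreeSpace W k ≤ ⨆ (m : ℤ) (_ : m ≤ k), degreeSpace W m :=
  le_iSup₂_of_le k le_rfl le_rfl

omit [CharZero K] [FiniteDimensional K M] in
/-- An operator of vertical degree `c` (`[h_ver, a] = c a`) maps `ver_k M` into `ver_{k+c} M`.
[cite: LooijengaLunts1997, §5 (5.3) p. 21 L4–L6, L45–L46] -/
theorem map_verFiltration_le_of_mem_adDegree {a : Module.End K M} {c : ℤ} (ha : a ∈ adDegree K W (c : K)) (k : ℤ) :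
    (⨆ (m : ℤ) (_ : m ≤ k), degreeSpace W m).map a ≤ ⨆ (m : ℤ) (_ : m ≤ k + c), degreeSpace W m :=
  Submodule.map_le_iff_le_comap.2 (iSup₂_le fun i hi v hv ↦
    Submodule.mem_iSup_of_mem (i + c) (Submodule.mem_iSup_of_mem (by omega) (mapsTo_of_mem_adDegree ha i hv)))

omit [CharZero K] [FiniteDimensional K M] in
/-- **Elements of `⊕_{l ≤ c} 𝔤𝔩(M)_l(ad h_ver)` raise the vertical filtration by at most `c`**: `a (ver_k M) ⊆ ver_{k+c} M`.
[cite: LooijengaLunts1997, §5 (5.3) p. 21 L4–L6, L45–L46] -/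
theorem apply_mem_verFiltration_of_mem_biSup_adDegree {a : Module.End K M} {c : ℤ}
    (ha : a ∈ ⨆ (l : ℤ) (_ : l ≤ c), adDegree K W (l : K)) (k : ℤ) {x : M}
    (hx : x ∈ ⨆ (m : ℤ) (_ : m ≤ k), degreeSpace W m) : a x ∈ ⨆ (m : ℤ) (_ : m ≤ k + c), degreeSpace W m := by
  revert hx x k
  refine Submodule.iSup_induction (fun l : ℤ ↦ ⨆ (_ : l ≤ c), adDegree K W (l : K))
    (motive := fun a ↦ ∀ (k : ℤ) (x : M), x ∈ ⨆ (m : ℤ) (_ : m ≤ k), degreeSpace W m →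
      a x ∈ ⨆ (m : ℤ) (_ : m ≤ k + c), degreeSpace W m) ha (fun l a ha k x hx ↦ ?_)
    (fun k x _ ↦ by rw [LinearMap.zero_apply]; exact Submodule.zero_mem _)
    (fun a b ha hb k x hx ↦ by rw [LinearMap.add_apply]; exact Submodule.add_mem _ (ha k x hx) (hb k x hx))
  by_cases hlc : l ≤ c
  · rw [iSup_pos hlc] at ha
    exact verFiltration_le_of_le W (by omega) (map_verFiltration_le_of_mem_adDegree ha k ⟨x, hx, rfl⟩)
  · rw [iSup_neg hlc, Submodule.mem_bot] at ha
    rw [ha, LinearMap.zero_apply]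
    exact Submodule.zero_mem _

/-- **Operators raising the vertical filtration by at most `c`, by components**: `a (ver_k M) ⊆ ver_{k+c} M` for all
`k` iff `a ∈ ⊕_{l ≤ c} 𝔤𝔩(M)_l(ad h_ver)` — the components of vertical degree `> c` vanish, "highest vertical degree
`c`". [cite: LooijengaLunts1997, §5 (5.3) p. 21 L45–L46 ("the components of 𝔞 of highest vertical degree 2")] -/
theorem forall_apply_mem_verFiltration_iff (hW : IsZGrading W) {a : Module.End K M} {c : ℤ} :
    (∀ k : ℤ, ∀ x ∈ ⨆ (m : ℤ) (_ : m ≤ k), degreeSpace W m, a x ∈ ⨆ (m : ℤ) (_ : m ≤ k + c), degreeSpace W m) ↔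
      a ∈ ⨆ (l : ℤ) (_ : l ≤ c), adDegree K W (l : K) := by
  refine ⟨fun h ↦ ?_, fun ha k x hx ↦ apply_mem_verFiltration_of_mem_biSup_adDegree ha k hx⟩
  simp_rw [← degreeSpace_ad_eq_adDegree]
  refine mem_biSup_of_degreeComponent_apply_eq_zero hW.ad fun m hm ↦ ?_
  refine hW.linearMap_ext fun i x hx ↦ ?_
  rw [LinearMap.zero_apply, degreeComponent_ad_apply_apply hW a m hx]
  exact degreeComponent_apply_eq_zero_of_mem_biSup (h i x (degreeSpace_le_verFiltration W i hx)) (by omega)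

/-- `a - a_c ∈ ⊕_{l ≤ c-1} 𝔤𝔩(M)_l(ad h_ver)` for `a ∈ ⊕_{l ≤ c} 𝔤𝔩(M)_l(ad h_ver)` (the highest component removed).
[cite: LooijengaLunts1997, §5 (5.3) p. 21 L45–L46] -/
theorem sub_degreeComponent_mem_biSup_le (hW : IsZGrading W) {a : Module.End K M} {c : ℤ}
    (ha : a ∈ ⨆ (l : ℤ) (_ : l ≤ c), adDegree K W (l : K)) :
    a - degreeComponent (LieAlgebra.ad K (Module.End K M) W) c a ∈ ⨆ (l : ℤ) (_ : l ≤ c - 1), adDegree K W (l : K) := by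
  simp_rw [← degreeSpace_ad_eq_adDegree] at ha ⊢
  refine mem_biSup_of_degreeComponent_apply_eq_zero hW.ad fun m hm ↦ ?_
  rw [map_sub]
  rcases eq_or_lt_of_le (show c ≤ m by omega) with rfl | hlt
  · rw [degreeComponent_apply_of_mem (degreeComponent_apply_mem hW.ad c a), sub_self]
  · rw [degreeComponent_apply_eq_zero_of_mem_biSup ha (show ¬m ≤ c by omega),
      degreeComponent_apply_of_mem_ne (degreeComponent_apply_mem hW.ad c a) (ne_of_lt hlt), sub_self]

omit [CharZero K] [FiniteDimensional K M] in
/-- The vertical filtration is split by the eigenspaces of `h_ver`: `ver_k M = M_k(h_ver) + ver_{k-1} M`.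
[cite: LooijengaLunts1997, §5 (5.3) p. 21 L24–L27; (5.1) p. 20 L103–L105] -/
theorem verFiltration_eq_sup (W : Module.End K M) (k : ℤ) :
    ⨆ (m : ℤ) (_ : m ≤ k), degreeSpace W m = degreeSpace W k ⊔ ⨆ (m : ℤ) (_ : m ≤ k - 1), degreeSpace W m := by
  refine le_antisymm (iSup₂_le fun m hm ↦ ?_) (sup_le (le_iSup₂_of_le k le_rfl le_rfl) (iSup₂_le fun m hm ↦ ?_))
  · rcases eq_or_lt_of_le hm with rfl | hlt
    · exact le_sup_left
    · exact le_sup_of_le_right (le_iSup₂_of_le m (by omega) le_rfl)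
  · exact le_iSup₂_of_le m (by omega) le_rfl

omit [FiniteDimensional K M] in
/-- … and `M_k(h_ver) ∩ ver_{k-1} M = 0`. [cite: LooijengaLunts1997, §5 (5.3) p. 21 L24–L27; (5.1) p. 20 L103–L105] -/
theorem disjoint_degreeSpace_verFiltration (W : Module.End K M) (k : ℤ) :
    Disjoint (degreeSpace W k) (⨆ (m : ℤ) (_ : m ≤ k - 1), degreeSpace W m) := by
  have h1 := (iSupIndep_def.1 (W.eigenspaces_iSupIndep.comp (f := fun k : ℤ ↦ (k : K)) Int.cast_injective)) k
  refine h1.mono_right (iSup₂_le fun m hm ↦ ?_)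
  exact le_iSup₂_of_le m (show m ≠ k by omega) le_rfl

omit [FiniteDimensional K M] in
/-- `M_k(h_ver) ∩ ver_{k'} M = 0` for `k' < k`. [cite: LooijengaLunts1997, §5 (5.1) p. 20 L103–L105] -/
theorem eq_zero_of_mem_degreeSpace_of_mem_verFiltration {k k' : ℤ} (hkk' : k' < k) {x : M}
    (hx : x ∈ degreeSpace W k) (hx' : x ∈ ⨆ (m : ℤ) (_ : m ≤ k'), degreeSpace W m) : x = 0 := by
  have h1 := (disjoint_degreeSpace_verFiltration W k).le_bot
    (Submodule.mem_inf.2 ⟨hx, verFiltration_le_of_le W (show k' ≤ k - 1 by omega) hx'⟩)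
  rwa [Submodule.mem_bot] at h1

/-- The vertical filtration is exhaustive: `ver_k M = M` for `k` above every weight of `h_ver`. [cite: LooijengaLunts1997, §5 (5.3) p. 21 L4–L5] -/
theorem exists_verFiltration_eq_top (hW : IsZGrading W) : ∃ k : ℤ, ⨆ (m : ℤ) (_ : m ≤ k), degreeSpace W m = ⊤ := by
  obtain ⟨k, hk⟩ := (finite_setOf_degreeSpace_ne_bot W).bddAbove
  refine ⟨k, ?_⟩
  rw [eq_top_iff, ← (show ⨆ m : ℤ, degreeSpace W m = ⊤ from hW)]
  refine iSup_le fun m ↦ ?_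
  by_cases hm : degreeSpace W m = ⊥
  · rw [hm]; exact bot_le
  · exact le_iSup₂_of_le m (hk hm) le_rfl

/-- … and separated: `ver_k M = 0` for `k` below every weight of `h_ver`. [cite: LooijengaLunts1997, §5 (5.3) p. 21 L4–L5] -/
theorem exists_verFiltration_eq_bot (W : Module.End K M) :
    ∃ k : ℤ, ⨆ (m : ℤ) (_ : m ≤ k), degreeSpace W m = ⊥ := by
  obtain ⟨k, hk⟩ := (finite_setOf_degreeSpace_ne_bot W).bddBelow
  refine ⟨k - 1, ?_⟩
  rw [eq_bot_iff]
  refine iSup₂_le fun m hm ↦ ?_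
  by_cases hm' : degreeSpace W m = ⊥
  · rw [hm']
  · exact absurd (hk hm') (by omega)

omit [CharZero K] [FiniteDimensional K M] in
/-- Powers: `a^n (ver_k M) ⊆ ver_{k+2n} M` for `a` raising the vertical filtration by `2`. [cite: LooijengaLunts1997, §5 (5.3) p. 21 L45–L48] -/
theorem pow_apply_mem_verFiltration {a : Module.End K M}
    (ha : ∀ k : ℤ, ∀ x ∈ ⨆ (m : ℤ) (_ : m ≤ k), degreeSpace W m, a x ∈ ⨆ (m : ℤ) (_ : m ≤ k + 2), degreeSpace W m)
    (n : ℕ) {k : ℤ} {x : M} (hx : x ∈ ⨆ (m : ℤ) (_ : m ≤ k), degreeSpace W m) :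
    (a ^ n) x ∈ ⨆ (m : ℤ) (_ : m ≤ k + 2 * n), degreeSpace W m := by
  induction n with
  | zero => simpa using hx
  | succ n ih =>
    rw [pow_succ', Module.End.mul_apply]
    exact verFiltration_le_of_le W (by push_cast; omega) (ha _ _ ih)

/-- The highest vertical component `a_2` of `a ∈ ⊕_{l ≤ 2} 𝔤𝔩(M)_l(ad h_ver)` has vertical degree `2`:
`a_2 (M_k(h_ver)) ⊆ M_{k+2}(h_ver)`. [cite: LooijengaLunts1997, §5 (5.3) p. 21 L45–L48] -/
theorem degreeComponent_ad_two_apply_mem (hW : IsZGrading W) (a : Module.End K M) {k : ℤ} {x : M}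
    (hx : x ∈ degreeSpace W k) : degreeComponent (LieAlgebra.ad K (Module.End K M) W) 2 a x ∈ degreeSpace W (k + 2) :=
  degreeComponent_ad_apply_mem_degreeSpace hW a 2 hx

/-- **`gr^ver(a^n) = a_2^n` on `Gr^ver_k M ≅ M_k(h_ver)`**: for `a ∈ ⊕_{l ≤ 2} 𝔤𝔩(M)_l(ad h_ver)` and `x ∈ M_k(h_ver)`,
`a^n x ≡ a_2^n x (mod ver_{k+2n-1} M)`. [cite: LooijengaLunts1997, §5 (5.3) p. 21 L45–L50] -/
theorem pow_apply_sub_pow_degreeComponent_apply_mem_verFiltration (hW : IsZGrading W) {a : Module.End K M}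
    (ha : a ∈ ⨆ (l : ℤ) (_ : l ≤ 2), adDegree K W (l : K)) (n : ℕ) {k : ℤ} {x : M} (hx : x ∈ degreeSpace W k) :
    (a ^ n) x - (degreeComponent (LieAlgebra.ad K (Module.End K M) W) 2 a ^ n) x ∈
      ⨆ (m : ℤ) (_ : m ≤ k + 2 * n - 1), degreeSpace W m := by
  induction n with
  | zero => simp
  | succ n ih =>
    have ha' := (forall_apply_mem_verFiltration_iff hW).2 ha
    have h3 := sub_degreeComponent_mem_biSup_le hW ha
    have e1 : (a ^ (n + 1)) x - (degreeComponent (LieAlgebra.ad K (Module.End K M) W) 2 a ^ (n + 1)) x =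
        a ((a ^ n) x - (degreeComponent (LieAlgebra.ad K (Module.End K M) W) 2 a ^ n) x) +
          (a - degreeComponent (LieAlgebra.ad K (Module.End K M) W) 2 a)
            ((degreeComponent (LieAlgebra.ad K (Module.End K M) W) 2 a ^ n) x) := by
      rw [pow_succ', pow_succ', Module.End.mul_apply, Module.End.mul_apply, map_sub, LinearMap.sub_apply]
      abel
    rw [e1]
    refine Submodule.add_mem _ ?_ ?_
    · exact verFiltration_le_of_le W (by push_cast; omega) (ha' _ _ ih)
    · have h4 : (degreeComponent (LieAlgebra.ad K (Module.End K M) W) 2 a ^ n) x ∈ degreeSpace W (k + 2 * n) :=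
        pow_apply_mem_degreeSpace (fun i y hy ↦ degreeComponent_ad_two_apply_mem hW a hy) hx n
      exact verFiltration_le_of_le W (by push_cast; omega)
        (apply_mem_verFiltration_of_mem_biSup_adDegree h3 _ (degreeSpace_le_verFiltration W _ h4))

/-- **"`a` has the Lefschetz property in `Gr^ver M`" ⟺ `a_2` (the highest vertical component) is a Lefschetz operator
of `(M, h_ver)`.**  Printed: "If in addition, `Gr^ver M` is a Lefschetz module of `𝔞`, then the span of the
components of `𝔞` of highest vertical degree `2` make up an abelian subalgebra `𝔞_{0,2}` […] that has the Lefschetz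
property in `M` with respect to the vertical grading."  For `a ∈ ⊕_{l ≤ 2} 𝔤𝔩(M)_l(ad W)`, `W = h_ver` (so `a` acts on
`Gr^ver M`, `ver_k M = ⊕_{m ≤ k} M_m(W)` nondecreasing, `a ver_k ⊆ ver_{k+2}`), the Lefschetz property of `a` on
`Gr^ver M` — "`a^n : Gr^ver_{-n} M ⥲ Gr^ver_n M` for all `n ≥ 0`", written in the lattice of submodules exactly as
the two clauses of the tree's `IsMonodromyWeightFiltration` (INJECTIVITY: `x ∈ ver_{-n}`, `a^n x ∈ ver_{n-1} ⟹ x ∈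
ver_{-n-1}`; SURJECTIVITY: `ver_n ⊆ a^n(ver_{-n}) + ver_{n-1}`; the orientation — `a` RAISES a nondecreasing
filtration — is the one of (5.3), opposite to Cattani's `N W_i ⊆ W_{i-2}`) — holds if and only if `a_2 = gr^ver(a)`
has the Lefschetz property on `M` graded by `W` (A1-88).  The vertical counterpart of A1-151. [cite: LooijengaLunts1997, §5 (5.3) p. 21 L4–L9, Proposition L45–L50; (5.1) p. 20 L99–L106] -/
theorem lefschetzOnGrVer_iff_hasLefschetzProperty (hW : IsZGrading W) {a : Module.End K M}
    (ha : a ∈ ⨆ (l : ℤ) (_ : l ≤ 2), adDegree K W (l : K)) :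
    (∀ n : ℕ,
      (∀ x ∈ ⨆ (m : ℤ) (_ : m ≤ -(n : ℤ)), degreeSpace W m,
          (a ^ n) x ∈ ⨆ (m : ℤ) (_ : m ≤ (n : ℤ) - 1), degreeSpace W m → x ∈ ⨆ (m : ℤ) (_ : m ≤ -(n : ℤ) - 1), degreeSpace W m) ∧
        (⨆ (m : ℤ) (_ : m ≤ (n : ℤ)), degreeSpace W m) ≤
          (⨆ (m : ℤ) (_ : m ≤ -(n : ℤ)), degreeSpace W m).map (a ^ n) ⊔ ⨆ (m : ℤ) (_ : m ≤ (n : ℤ) - 1), degreeSpace W m) ↔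
      HasLefschetzProperty W (degreeComponent (LieAlgebra.ad K (Module.End K M) W) 2 a) := by
  have ha' := (forall_apply_mem_verFiltration_iff hW).2 ha
  have hmaps : ∀ k : ℤ, MapsTo (degreeComponent (LieAlgebra.ad K (Module.End K M) W) 2 a) (degreeSpace W k)
      (degreeSpace W (k + 2)) := fun k x hx ↦ degreeComponent_ad_two_apply_mem hW a hx
  have hpow : ∀ (n : ℕ) {k : ℤ} {x : M}, x ∈ degreeSpace W k →
      (degreeComponent (LieAlgebra.ad K (Module.End K M) W) 2 a ^ n) x ∈ degreeSpace W (k + 2 * n) :=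
    fun n k x hx ↦ pow_apply_mem_degreeSpace hmaps hx n
  constructor
  · intro hL
    refine ⟨hmaps, fun n ↦ ⟨fun x hx ↦ ?_, fun x₀ hx₀ x₁ hx₁ hxx ↦ ?_, fun y₀ hy₀ ↦ ?_⟩⟩
    · have h1 := hpow n hx
      rwa [show -(n : ℤ) + 2 * n = n by ring] at h1
    · -- injective on `M_{-n}`
      rw [← sub_eq_zero]
      have hd : x₀ - x₁ ∈ degreeSpace W (-(n : ℤ)) := Submodule.sub_mem _ hx₀ hx₁
      have hd0 : (degreeComponent (LieAlgebra.ad K (Module.End K M) W) 2 a ^ n) (x₀ - x₁) = 0 := by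
        rw [map_sub, sub_eq_zero]; exact hxx
      have h2 := pow_apply_sub_pow_degreeComponent_apply_mem_verFiltration hW ha n hd
      rw [hd0, sub_zero] at h2
      have h4 := (hL n).1 (x₀ - x₁) (degreeSpace_le_verFiltration W _ hd)
        (verFiltration_le_of_le W (by omega) h2)
      exact eq_zero_of_mem_degreeSpace_of_mem_verFiltration (show -(n : ℤ) - 1 < -(n : ℤ) by omega) hd h4
    · -- surjective onto `M_n`
      obtain ⟨z, hz, r, hr, hzr⟩ := Submodule.mem_sup.1 ((hL n).2 (degreeSpace_le_verFiltration W _ hy₀))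
      obtain ⟨x, hx, rfl⟩ := Submodule.mem_map.1 hz
      rw [verFiltration_eq_sup] at hx
      obtain ⟨x₀, hx₀, x', hx'', rfl⟩ := Submodule.mem_sup.1 hx
      refine ⟨x₀, hx₀, ?_⟩
      have h5 : y₀ - (degreeComponent (LieAlgebra.ad K (Module.End K M) W) 2 a ^ n) x₀ ∈
          ⨆ (m : ℤ) (_ : m ≤ (n : ℤ) - 1), degreeSpace W m := by
        have e1 : y₀ - (degreeComponent (LieAlgebra.ad K (Module.End K M) W) 2 a ^ n) x₀ =
            ((a ^ n) x₀ - (degreeComponent (LieAlgebra.ad K (Module.End K M) W) 2 a ^ n) x₀) + (a ^ n) x' + r := by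
          rw [← hzr, map_add]; abel
        rw [e1]
        refine Submodule.add_mem _ (Submodule.add_mem _ ?_ ?_) hr
        · exact verFiltration_le_of_le W (by omega)
            (pow_apply_sub_pow_degreeComponent_apply_mem_verFiltration hW ha n hx₀)
        · exact verFiltration_le_of_le W (by omega) (pow_apply_mem_verFiltration ha' n hx'')
      have h6 : y₀ - (degreeComponent (LieAlgebra.ad K (Module.End K M) W) 2 a ^ n) x₀ ∈ degreeSpace W n := by
        refine Submodule.sub_mem _ hy₀ ?_
        have h1 := hpow n hx₀
        rwa [show -(n : ℤ) + 2 * n = n by ring] at h1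
      have h7 := eq_zero_of_mem_degreeSpace_of_mem_verFiltration (show (n : ℤ) - 1 < n by omega) h6 h5
      rw [sub_eq_zero] at h7
      exact h7.symm
  · intro L n
    refine ⟨fun x hx hax ↦ ?_, fun y hy ↦ ?_⟩
    · -- injectivity on `Gr^ver`
      rw [verFiltration_eq_sup] at hx
      obtain ⟨x₀, hx₀, x', hx', rfl⟩ := Submodule.mem_sup.1 hx
      have h1 : (degreeComponent (LieAlgebra.ad K (Module.End K M) W) 2 a ^ n) x₀ ∈
          ⨆ (m : ℤ) (_ : m ≤ (n : ℤ) - 1), degreeSpace W m := by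
        have e1 : (degreeComponent (LieAlgebra.ad K (Module.End K M) W) 2 a ^ n) x₀ =
            (a ^ n) (x₀ + x') - (a ^ n) x' -
              ((a ^ n) x₀ - (degreeComponent (LieAlgebra.ad K (Module.End K M) W) 2 a ^ n) x₀) := by
          rw [map_add]; abel
        rw [e1]
        refine Submodule.sub_mem _ (Submodule.sub_mem _ hax ?_) ?_
        · exact verFiltration_le_of_le W (by omega) (pow_apply_mem_verFiltration ha' n hx')
        · exact verFiltration_le_of_le W (by omega)
            (pow_apply_sub_pow_degreeComponent_apply_mem_verFiltration hW ha n hx₀)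
      have h2 : (degreeComponent (LieAlgebra.ad K (Module.End K M) W) 2 a ^ n) x₀ ∈ degreeSpace W n := by
        have h3 := hpow n hx₀
        rwa [show -(n : ℤ) + 2 * n = n by ring] at h3
      have h4 := eq_zero_of_mem_degreeSpace_of_mem_verFiltration (show (n : ℤ) - 1 < n by omega) h2 h1
      have h5 : x₀ = 0 := L.eq_zero_of_pow_apply_eq_zero (n := n) (by omega) hx₀ (by rwa [Int.toNat_natCast])
      rw [h5, zero_add x']
      exact hx'
    · -- surjectivity on `Gr^ver`
      rw [verFiltration_eq_sup] at hy
      obtain ⟨y₀, hy₀, y', hy'', rfl⟩ := Submodule.mem_sup.1 hy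
      obtain ⟨x₀, hx₀, hx₀y⟩ := (L.bijOn n).surjOn hy₀
      refine Submodule.mem_sup.2 ⟨(a ^ n) x₀, Submodule.mem_map_of_mem (degreeSpace_le_verFiltration W _ hx₀),
        y₀ + y' - (a ^ n) x₀, ?_, by abel⟩
      have e1 : y₀ + y' - (a ^ n) x₀ =
          y' - ((a ^ n) x₀ - (degreeComponent (LieAlgebra.ad K (Module.End K M) W) 2 a ^ n) x₀) := by
        rw [← hx₀y]; abel
      rw [e1]
      refine Submodule.sub_mem _ hy'' ?_
      exact verFiltration_le_of_le W (by omega)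
        (pow_apply_sub_pow_degreeComponent_apply_mem_verFiltration hW ha n hx₀)

end VerFiltration

/-! ### The vertical components of `𝔞_ver` and A1-150's vertical Lefschetz module under the PRINTED hypothesis -/

section VerticalZeroTwo

variable {K : Type*} [Field K] [CharZero K] {M : Type*} [AddCommGroup M] [Module K M] [FiniteDimensional K M]
  {h H : Module.End K M} {𝔞 : Submodule K (Module.End K M)}

/-- **Horizontal versus vertical components of an operator of total degree `2`**: for `[h, H] = 0` and
`a ∈ 𝔤𝔩(M)_2(ad h)`, the component of `a` of vertical degree `l` (under `ad (h - H)`) is its component of horizontal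
degree `2 - l` (under `ad H`) — `a = Σ_j a_{j, 2-j}`. [cite: LooijengaLunts1997, §5 (5.3) p. 21 L27–L30, L45–L46] -/
theorem degreeComponent_ad_sub_eq (hH : IsZGrading H) (hHh : H ∈ adDegree K h 0) {a : Module.End K M}
    (ha : a ∈ adDegree K h 2) (l : ℤ) :
    degreeComponent (LieAlgebra.ad K (Module.End K M) (h - H)) l a =
      degreeComponent (LieAlgebra.ad K (Module.End K M) H) (2 - l) a := by
  classical
  have hT := hH.ad
  -- expand `a = Σ_j a_j` along `ad H` and take vertical components termwise
  conv_lhs => rw [← sum_degreeComponent_apply hT (S := (finite_setOf_degreeSpace_ne_bot _).toFinset)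
    (fun k hk ↦ (finite_setOf_degreeSpace_ne_bot _).mem_toFinset.2 hk) a]
  rw [map_sum]
  have hterm : ∀ j : ℤ, degreeComponent (LieAlgebra.ad K (Module.End K M) (h - H)) l
      (degreeComponent (LieAlgebra.ad K (Module.End K M) H) j a) =
        if j = 2 - l then degreeComponent (LieAlgebra.ad K (Module.End K M) H) j a else 0 := by
    intro j
    have hdeg := degreeComponent_ad_mem_adDegree_sub hHh ha hH j
    rw [show (2 : K) - (j : K) = ((2 - j : ℤ) : K) by push_cast; ring, ← degreeSpace_ad_eq_adDegree] at hdeg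
    rw [degreeComponent_spec _ l (2 - j) _ hdeg]
    by_cases hj : j = 2 - l
    · rw [if_pos hj, if_pos (by omega)]
    · rw [if_neg hj, if_neg (by omega)]
  simp_rw [hterm]
  rw [Finset.sum_ite_eq' ]
  split_ifs with hmem
  · rfl
  · -- `2 - l` is not a weight of `ad H`: the component vanishes
    have hbot : degreeSpace (LieAlgebra.ad K (Module.End K M) H) (2 - l) = ⊥ := by
      by_contra hne
      exact hmem ((finite_setOf_degreeSpace_ne_bot _).mem_toFinset.2 hne)
    have h1 := degreeComponent_apply_mem hT (2 - l) a
    rw [hbot, Submodule.mem_bot] at h1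
    exact h1.symm

/-- An element of `𝔞_ver` (total degree `2`, no negative horizontal degrees) has vertical components of degrees `≤ 2`
only: `𝔞_ver ⊆ ⊕_{l ≤ 2} 𝔤𝔩(M)_l(ad h_ver)` — "the components of `𝔞` of highest vertical degree `2`".
[cite: LooijengaLunts1997, §5 (5.3) p. 21 L45–L46] -/
theorem mem_biSup_adDegree_sub_of_mem_verticalPart (hH : IsZGrading H) (hHh : H ∈ adDegree K h 0)
    (hgr : IsZGrading h) (h𝔞 : 𝔞 ≤ adDegree K h 2) {a : Module.End K M} (ha : a ∈ verticalPart H 𝔞) :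
    a ∈ ⨆ (l : ℤ) (_ : l ≤ 2), adDegree K (h - H) (l : K) := by
  have hW : IsZGrading (h - H) := isZGrading_sub_of_commute hgr hH (mul_comm_of_mem_adDegree_zero hHh)
  obtain ⟨ha𝔞, ha0⟩ := (mem_verticalPart_iff_mem_biSup hH).1 ha
  simp_rw [← degreeSpace_ad_eq_adDegree] at ha0 ⊢
  refine mem_biSup_of_degreeComponent_apply_eq_zero hW.ad fun l hl ↦ ?_
  rw [degreeComponent_ad_sub_eq hH hHh (h𝔞 ha𝔞) l]
  exact degreeComponent_apply_eq_zero_of_mem_biSup ha0 (by omega)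

/-- … and its highest vertical component is `a_{0,2} = a_0`: `degreeComponent (ad h_ver) 2 a = degreeComponent (ad h_hor) 0 a`.
[cite: LooijengaLunts1997, §5 (5.3) p. 21 L45–L46] -/
theorem degreeComponent_ad_sub_two_eq (hH : IsZGrading H) (hHh : H ∈ adDegree K h 0) {a : Module.End K M}
    (ha : a ∈ adDegree K h 2) :
    degreeComponent (LieAlgebra.ad K (Module.End K M) (h - H)) 2 a =
      degreeComponent (LieAlgebra.ad K (Module.End K M) H) 0 a := by
  rw [degreeComponent_ad_sub_eq hH hHh ha 2, sub_self]

/-- **A1-150's vertical Lefschetz module under the PRINTED hypothesis.**  "If in addition, `Gr^ver M` is a Lefschetz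
module of `𝔞`, then […] `𝔞_{0,2}` […] has the Lefschetz property in `M` with respect to the vertical grading": with the
Lefschetz element of `Gr^ver M` given in the printed form — some `a ∈ 𝔞_ver` with `a^n : Gr^ver_{-n} M ⥲ Gr^ver_n M`
for all `n` (the lattice clauses of `lefschetzOnGrVer_iff_hasLefschetzProperty`) — and
`𝔤(𝔞_{0,2}, M_ver) = 𝔤(𝔞, Gr^ver M)` semisimple, `(𝔞_{0,2}, M_ver)` is a Lefschetz module (A1-150
`IsLefschetzModule.isLefschetzModule_verticalZeroTwo` composed with the bridge). [cite: LooijengaLunts1997, §5 (5.3) Proposition, p. 21 L45–L50] -/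
theorem IsLefschetzModule.isLefschetzModule_verticalZeroTwo_of_lefschetzOnGrVer (A : IsLefschetzModule K h 𝔞)
    (hH : IsZGrading H) (hHh : H ∈ adDegree K h 0) (hW0 : h - H ≠ 0) {a : Module.End K M}
    (ha : a ∈ verticalPart H 𝔞)
    (hL : ∀ n : ℕ,
      (∀ x ∈ ⨆ (m : ℤ) (_ : m ≤ -(n : ℤ)), degreeSpace (h - H) m,
          (a ^ n) x ∈ ⨆ (m : ℤ) (_ : m ≤ (n : ℤ) - 1), degreeSpace (h - H) m →
            x ∈ ⨆ (m : ℤ) (_ : m ≤ -(n : ℤ) - 1), degreeSpace (h - H) m) ∧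
        (⨆ (m : ℤ) (_ : m ≤ (n : ℤ)), degreeSpace (h - H) m) ≤
          (⨆ (m : ℤ) (_ : m ≤ -(n : ℤ)), degreeSpace (h - H) m).map (a ^ n) ⊔
            ⨆ (m : ℤ) (_ : m ≤ (n : ℤ) - 1), degreeSpace (h - H) m)
    (hss : LieAlgebra.IsSemisimple K (lefschetzLieAlgebra K (h - H) (verticalZeroTwo H 𝔞))) :
    IsLefschetzModule K (h - H) (verticalZeroTwo H 𝔞) := by
  have hW : IsZGrading (h - H) := isZGrading_sub_of_commute A.isZGrading hH (mul_comm_of_mem_adDegree_zero hHh)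
  have hL' := (lefschetzOnGrVer_iff_hasLefschetzProperty hW
    (mem_biSup_adDegree_sub_of_mem_verticalPart hH hHh A.isZGrading A.le_adDegree_two ha)).1 hL
  rw [degreeComponent_ad_sub_two_eq hH hHh (A.le_adDegree_two ha.1)] at hL'
  exact A.isLefschetzModule_verticalZeroTwo hH hHh hW0 ha hL' hss

end VerticalZeroTwo

end Literature.Algebra.Lie
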